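import Summits.QuantumFields.YangMills.Theorems.HyperbolicRegulatorCurvatureUniformityRAdmLemmas
import Summits.QuantumFields.YangMills.Theorems.HyperbolicToTorus.Negative.InteriorChartDegree

/-!
# Route `HyperbolicRegulator`, crux `CurvatureUniformityR` (stmt-QuantumFields-18154), line `single-chart-markov`:
# stub `stub_chartInterior` — the `G`-free chart combinatorics `ChartInteriorStructure`

For a repaired-admissible finite square complex (`SingleChartMarkov.AdmR`, nine axioms) and a flat base point `x`
(`IsFlatR`), the flat `ℤ²`-chart `cV x` / `cE x` of sup-radius `(k:ℤ)/4` (axiom 9) satisfies: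

* (E0) `cE_inj` — chart edge ids are injective on box edges: the endpoint pair of `(cE x a μ).1` is
  `{cV x a, cV x (nx2 a μ)}` (`chart_edge_pair`), so equal ids give equal endpoint pairs, hence (chart injectivity)
  equal grid endpoint pairs, and the grid step `nx2` raises `a.1 + a.2` by one, which rules out the crossed matching;
* (E1) `edgesAt_eq` — at an interior grid point `a` (`|a.1|, |a.2| ≤ (k:ℤ)/4 − 1`) the edges of `E` at `cV x a` are
  exactly the four chart edges: the degree is `4` or `5` (axiom 4) and not `5` (the landed
  `Negative.card_edgesAt_ne_five_of_boxChart`, instantiated in `degOf_chart_ne_five`), and the four chart edges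
  are pairwise distinct edges at `cV x a` (E0), so they exhaust the filter;
* (E2) `sq_through_edge_zero` / `sq_through_edge_one` — a square of `Q` through an interior chart edge is one of the
  two flanking chart squares: both flanking unit grid squares are squares of `Q` through the edge (axiom 9), they are
  different (their edge-id sets differ, by E0), and every edge lies in exactly two squares (axiom 3,
  `Negative.false_of_three_squares`).

Elementary combinatorics of square complexes (folklore); nothing is asserted about the route beyond the registered stub.
-/

set_option autoImplicit false

namespace Summit.QuantumFields.YangMills.Cruxes.CurvatureUniformityR.SingleChartMarkov

open Finset Summit.QuantumFields.YangMills.Theorems.HyperbolicToTorus.Negative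
open Summit.QuantumFields.YangMills.Cruxes.HyperbolicToTorus.NoAdmissibleComplex (graphOf degOf conesOf)

namespace StubChartInterior

/-- The horizontal grid step: `nx2 a 0 = a + e₁`. -/
theorem nx2_zero (a : ℤ × ℤ) : nx2 a 0 = (a.1 + 1, a.2) := rfl

/-- The vertical grid step: `nx2 a 1 = a + e₂`. -/
theorem nx2_one (a : ℤ × ℤ) : nx2 a 1 = (a.1, a.2 + 1) := rfl

section Squares

variable {E Q : Finset ℕ} {bd : ℕ → Fin 4 → ℕ × Bool}

/-- Under axiom 3 (every edge in exactly two squares), if two different squares `qa ≠ qb` of `Q` pass through the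
edge `e ∈ E`, then every square of `Q` through `e` is `qa` or `qb`. -/
theorem eq_or_eq_of_two_squares (h3 : ∀ e ∈ E, (Q.filter fun q => ∃ i, (bd q i).1 = e).card = 2) {e : ℕ}
    (he : e ∈ E) {qa qb q : ℕ} (hqa : qa ∈ Q) (hqb : qb ∈ Q) (hq : q ∈ Q) (hea : ∃ i, (bd qa i).1 = e)
    (heb : ∃ i, (bd qb i).1 = e) (heq : ∃ i, (bd q i).1 = e) (hab : qa ≠ qb) : q = qa ∨ q = qb := by
  by_contra hne
  rw [not_or] at hne
  exact false_of_three_squares h3 he hq hqa hqb heq hea heb hne.1 hne.2 hab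

end Squares

variable {k j : ℕ} {V E Q : Finset ℕ} {σ τ : ℕ → ℕ} {bd : ℕ → Fin 4 → ℕ × Bool} {cV : ℕ → ℤ × ℤ → ℕ}
  {cE : ℕ → ℤ × ℤ → Fin 2 → ℕ × Bool} {x : ℕ}

/-- A chart edge `cE x a μ` (axiom 9) is an edge of `E` with endpoint pair `{cV x a, cV x (nx2 a μ)}`, whatever its
orientation flag. -/
theorem chart_edge_pair (hA : AdmR k j V E Q σ τ bd cV cE) (hx : IsFlatR k V E σ τ x) (a : ℤ × ℤ)
    (μ : Fin 2) (ha : inBox2 k a) (hb : inBox2 k (nx2 a μ)) :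
    (cE x a μ).1 ∈ E ∧ ({σ (cE x a μ).1, τ (cE x a μ).1} : Finset ℕ) = {cV x a, cV x (nx2 a μ)} := by
  obtain ⟨hE, hs, he⟩ := hA.chart_edge hx a μ ha hb
  refine ⟨hE, ?_⟩
  by_cases h : (cE x a μ).2 = true
  · rw [if_pos h] at hs he
    rw [hs, he]
  · rw [if_neg h] at hs he
    rw [hs, he, pair_comm]

/-- **(E0) Chart edge ids are injective on box edges.** Equal ids force equal endpoint pairs
(`chart_edge_pair`), hence equal grid endpoint pairs by injectivity of `cV x` on the box; the crossed matching
`a = nx2 a' μ'`, `nx2 a μ = a'` is impossible since `nx2` raises `a.1 + a.2` by one, and `nx2 a μ = nx2 a μ'`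
forces `μ = μ'`. -/
theorem cE_inj (hA : AdmR k j V E Q σ τ bd cV cE) (hx : IsFlatR k V E σ τ x) {a a' : ℤ × ℤ}
    {μ μ' : Fin 2} (ha : inBox2 k a) (hb : inBox2 k (nx2 a μ)) (ha' : inBox2 k a')
    (hb' : inBox2 k (nx2 a' μ')) (h : (cE x a μ).1 = (cE x a' μ').1) : a = a' ∧ μ = μ' := by
  obtain ⟨-, hp⟩ := chart_edge_pair hA hx a μ ha hb
  obtain ⟨-, hp'⟩ := chart_edge_pair hA hx a' μ' ha' hb'
  rw [h, hp'] at hp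
  have hinj := (hA.chart hx).2.2.1
  have h1 : cV x a ∈ ({cV x a', cV x (nx2 a' μ')} : Finset ℕ) := hp ▸ mem_insert_self _ _
  have h2 : cV x (nx2 a μ) ∈ ({cV x a', cV x (nx2 a' μ')} : Finset ℕ) :=
    hp ▸ mem_insert_of_mem (mem_singleton_self _)
  simp only [mem_insert, mem_singleton] at h1 h2
  have g1 : a = a' ∨ a = nx2 a' μ' := h1.imp (hinj ha ha') (hinj ha hb')
  have g2 : nx2 a μ = a' ∨ nx2 a μ = nx2 a' μ' := h2.imp (hinj hb ha') (hinj hb hb')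
  obtain ⟨p, q⟩ := a
  obtain ⟨p', q'⟩ := a'
  obtain rfl | rfl : μ = 0 ∨ μ = 1 := by omega
  all_goals obtain rfl | rfl : μ' = 0 ∨ μ' = 1 := by omega
  all_goals simp only [nx2_zero, nx2_one, Prod.mk.injEq, and_true] at g1 g2 ⊢
  all_goals omega

/-- (E0), contrapositive: chart edges at different grid edges of the box have different ids. -/
theorem cE_ne (hA : AdmR k j V E Q σ τ bd cV cE) (hx : IsFlatR k V E σ τ x) {a a' : ℤ × ℤ}
    {μ μ' : Fin 2} (ha : inBox2 k a) (hb : inBox2 k (nx2 a μ)) (ha' : inBox2 k a')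
    (hb' : inBox2 k (nx2 a' μ')) (hne : a.1 ≠ a'.1 ∨ a.2 ≠ a'.2 ∨ μ ≠ μ') :
    (cE x a μ).1 ≠ (cE x a' μ').1 := by
  intro h
  obtain ⟨rfl, rfl⟩ := cE_inj hA hx ha hb ha' hb' h
  simp at hne

/-- **A cone is never an interior chart point** (repaired admissibility): the chart image of an interior box point
(`|a.1|, |a.2| ≤ (k:ℤ)/4 - 1`) at a flat vertex does not have degree `5` — the landed
`Negative.card_edgesAt_ne_five_of_boxChart` instantiated from `AdmR` by destructuring (twin of
`NoAdmissibleComplex.Adm.degOf_chart_ne_five`). -/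
theorem degOf_chart_ne_five (hA : AdmR k j V E Q σ τ bd cV cE) (hx : IsFlatR k V E σ τ x)
    {a : ℤ × ℤ} (ha1 : |a.1| ≤ (k : ℤ) / 4 - 1) (ha2 : |a.2| ≤ (k : ℤ) / 4 - 1) :
    degOf E σ τ (cV x a) ≠ 5 := by
  have h := card_edgesAt_ne_five_of_boxChart
    (σ := σ) (τ := τ) (E := E) (Q := Q) (bd := bd)
    (st := fun e : ℕ × Bool => if e.2 then σ e.1 else τ e.1)
    (en := fun e : ℕ × Bool => if e.2 then τ e.1 else σ e.1)
    (nx := fun (a : ℤ × ℤ) (μ : Fin 2) => if μ = 0 then (a.1 + 1, a.2) else (a.1, a.2 + 1))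
    (fun e => by by_cases h : e.2 <;> simp [h, Finset.pair_comm]) (fun _ => rfl) (fun _ => rfl)
    hA.squares hA.2.2.1 ((k : ℤ) / 4) (cV x) (cE x) (hA.chart hx).2.2.1
    (fun a μ ha hb => hA.chart_edge hx a μ ha hb) (fun a ha hb => (hA.chart hx).2.2.2.2 a ha hb)
    a ha1 ha2
  simpa [degOf] using h

/-- **(E1) The edges at an interior chart vertex.** For `|a.1|, |a.2| ≤ (k:ℤ)/4 − 1` the edges of `E` at `cV x a`
are exactly the four chart edges (right and up based at `a`, right based at the left neighbour, up based at the
lower neighbour): they are pairwise distinct edges at `cV x a` (E0, `chart_edge_pair`) and the degree is `4`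
(axiom 4 and `degOf_chart_ne_five`). -/
theorem edgesAt_eq (hA : AdmR k j V E Q σ τ bd cV cE) (hx : IsFlatR k V E σ τ x) {a : ℤ × ℤ}
    (h1 : |a.1| ≤ (k : ℤ) / 4 - 1) (h2 : |a.2| ≤ (k : ℤ) / 4 - 1) :
    E.filter (fun e => σ e = cV x a ∨ τ e = cV x a) =
      {(cE x a 0).1, (cE x a 1).1, (cE x (a.1 - 1, a.2) 0).1, (cE x (a.1, a.2 - 1) 1).1} := by
  -- degree four
  have hne5 := degOf_chart_ne_five hA hx h1 h2
  rw [abs_le] at h1 h2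
  have bA : inBox2 k a := by simp only [inBox2, abs_le]; omega
  have h4 : (E.filter fun e => σ e = cV x a ∨ τ e = cV x a).card = 4 := by
    have h45 := (hA.degree _ ((hA.chart hx).2.1 a bA)).1
    unfold degOf at h45 hne5
    omega
  -- box bookkeeping
  have bR : inBox2 k (nx2 a 0) := by simp only [inBox2, nx2_zero, abs_le]; omega
  have bU : inBox2 k (nx2 a 1) := by simp only [inBox2, nx2_one, abs_le]; omega
  have bL : inBox2 k (a.1 - 1, a.2) := by simp only [inBox2, abs_le]; omega
  have bD : inBox2 k (a.1, a.2 - 1) := by simp only [inBox2, abs_le]; omega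
  have eL : nx2 (a.1 - 1, a.2) 0 = a := by simp only [nx2_zero, sub_add_cancel, Prod.mk.eta]
  have eD : nx2 (a.1, a.2 - 1) 1 = a := by simp only [nx2_one, sub_add_cancel, Prod.mk.eta]
  have bLn : inBox2 k (nx2 (a.1 - 1, a.2) 0) := by rw [eL]; exact bA
  have bDn : inBox2 k (nx2 (a.1, a.2 - 1) 1) := by rw [eD]; exact bA
  -- the four chart edges at `a`
  obtain ⟨hRE, hRp⟩ := chart_edge_pair hA hx a 0 bA bR
  obtain ⟨hUE, hUp⟩ := chart_edge_pair hA hx a 1 bA bU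
  obtain ⟨hLE, hLp⟩ := chart_edge_pair hA hx (a.1 - 1, a.2) 0 bL bLn
  obtain ⟨hDE, hDp⟩ := chart_edge_pair hA hx (a.1, a.2 - 1) 1 bD bDn
  rw [eL] at hLp
  rw [eD] at hDp
  -- pairwise distinct
  have dRU := cE_ne hA hx bA bR bA bU (Or.inr (Or.inr (by decide)))
  have dRL := cE_ne hA hx bA bR bL bLn (Or.inl (by simp; omega))
  have dRD := cE_ne hA hx bA bR bD bDn (Or.inr (Or.inl (by simp; omega)))
  have dUL := cE_ne hA hx bA bU bL bLn (Or.inl (by simp; omega))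
  have dUD := cE_ne hA hx bA bU bD bDn (Or.inr (Or.inl (by simp; omega)))
  have dLD := cE_ne hA hx bL bLn bD bDn (Or.inl (by simp))
  symm
  apply eq_of_subset_of_card_le
  · intro e he
    rw [mem_filter, ← mem_endpair_iff]
    simp only [mem_insert, mem_singleton] at he
    rcases he with rfl | rfl | rfl | rfl
    · exact ⟨hRE, by rw [hRp]; exact mem_insert_self _ _⟩
    · exact ⟨hUE, by rw [hUp]; exact mem_insert_self _ _⟩
    · exact ⟨hLE, by rw [hLp]; exact mem_insert_of_mem (mem_singleton_self _)⟩
    · exact ⟨hDE, by rw [hDp]; exact mem_insert_of_mem (mem_singleton_self _)⟩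
  · rw [h4, card_insert_of_notMem (by simp [dRU, dRL, dRD]), card_insert_of_notMem (by simp [dUL, dUD]),
      card_insert_of_notMem (by simp [dLD]), card_singleton]

/-- **(E2), horizontal edge.** A square of `Q` through the interior chart edge `cE x a 0` (both flanking unit grid
squares inside the box) is the chart square at `a` or the chart square at `(a.1, a.2 - 1)`: both are squares of `Q`
through the edge (axiom 9), they differ (the up-edge at `a` belongs to the first edge-id set only, by E0), and the
edge lies in exactly two squares (axiom 3). -/
theorem sq_through_edge_zero (hA : AdmR k j V E Q σ τ bd cV cE) (hx : IsFlatR k V E σ τ x) (a : ℤ × ℤ)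
    (ha : inBox2 k a) (hb : inBox2 k (a.1 + 1, a.2)) (hc : inBox2 k (a.1 + 1, a.2 + 1))
    (hd : inBox2 k (a.1, a.2 - 1)) {q : ℕ} (hq : q ∈ Q) (hqe : ∃ i, (bd q i).1 = (cE x a 0).1) :
    Finset.univ.image (Prod.fst ∘ bd q) =
        {(cE x a 0).1, (cE x (nx2 a 0) 1).1, (cE x (nx2 a 1) 0).1, (cE x a 1).1} ∨
      Finset.univ.image (Prod.fst ∘ bd q) =
        {(cE x (a.1, a.2 - 1) 0).1, (cE x (nx2 (a.1, a.2 - 1) 0) 1).1, (cE x (nx2 (a.1, a.2 - 1) 1) 0).1,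
          (cE x (a.1, a.2 - 1) 1).1} := by
  -- box bookkeeping
  have bR : inBox2 k (nx2 a 0) := hb
  have bU : inBox2 k (nx2 a 1) := by simp only [inBox2, nx2_one, abs_le] at *; omega
  have eD : nx2 (a.1, a.2 - 1) 1 = a := by simp only [nx2_one, sub_add_cancel, Prod.mk.eta]
  have bDU : inBox2 k (nx2 (a.1, a.2 - 1) 1) := by rw [eD]; exact ha
  have bDR : inBox2 k (nx2 (a.1, a.2 - 1) 0) := by simp only [inBox2, nx2_zero, abs_le] at *; omega
  have bDR' : inBox2 k (a.1 + 1, a.2 - 1) := by simp only [inBox2, abs_le] at *; omega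
  have bDRU : inBox2 k (nx2 (a.1 + 1, a.2 - 1) 1) := by simp only [inBox2, nx2_one, abs_le] at *; omega
  have bD1 : inBox2 k ((a.1, a.2 - 1).1 + 1, (a.1, a.2 - 1).2 + 1) := by
    simp only [inBox2, abs_le] at *; omega
  -- the edge and its two flanking chart squares
  obtain ⟨heE, -⟩ := chart_edge_pair hA hx a 0 ha bR
  obtain ⟨qa, hqaQ, hqa⟩ := (hA.chart hx).2.2.2.2 a ha hc
  obtain ⟨qb, hqbQ, hqb⟩ := (hA.chart hx).2.2.2.2 (a.1, a.2 - 1) hd bD1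
  have hea : ∃ i, (bd qa i).1 = (cE x a 0).1 := mem_image_fst_bd.1 (by rw [hqa]; simp)
  have heb : ∃ i, (bd qb i).1 = (cE x a 0).1 := mem_image_fst_bd.1 (by rw [hqb, eD]; simp)
  -- the two flanking squares differ: the up-edge at `a` is an edge of `qa` but not of `qb`
  have hab : qa ≠ qb := by
    intro h
    have hm : (cE x a 1).1 ∈ Finset.univ.image (Prod.fst ∘ bd qb) := by rw [← h, hqa]; simp
    rw [hqb, eD] at hm
    simp only [nx2_zero, mem_insert, mem_singleton] at hm
    rcases hm with hm | hm | hm | hm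
    · exact cE_ne hA hx ha bU hd bDR (Or.inr (Or.inr (by decide))) hm
    · exact cE_ne hA hx ha bU bDR' bDRU (Or.inl (by simp)) hm
    · exact cE_ne hA hx ha bU ha bR (Or.inr (Or.inr (by decide))) hm
    · exact cE_ne hA hx ha bU hd bDU (Or.inr (Or.inl (by simp; omega))) hm
  rcases eq_or_eq_of_two_squares hA.2.2.1 heE hqaQ hqbQ hq hea heb hqe hab with rfl | rfl
  · exact Or.inl hqa
  · exact Or.inr hqb

/-- **(E2), vertical edge.** A square of `Q` through the interior chart edge `cE x a 1` (both flanking unit grid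
squares inside the box) is the chart square at `a` or the chart square at `(a.1 - 1, a.2)`. -/
theorem sq_through_edge_one (hA : AdmR k j V E Q σ τ bd cV cE) (hx : IsFlatR k V E σ τ x) (a : ℤ × ℤ)
    (ha : inBox2 k a) (hb : inBox2 k (a.1, a.2 + 1)) (hc : inBox2 k (a.1 + 1, a.2 + 1))
    (hd : inBox2 k (a.1 - 1, a.2)) {q : ℕ} (hq : q ∈ Q) (hqe : ∃ i, (bd q i).1 = (cE x a 1).1) :
    Finset.univ.image (Prod.fst ∘ bd q) =
        {(cE x a 0).1, (cE x (nx2 a 0) 1).1, (cE x (nx2 a 1) 0).1, (cE x a 1).1} ∨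
      Finset.univ.image (Prod.fst ∘ bd q) =
        {(cE x (a.1 - 1, a.2) 0).1, (cE x (nx2 (a.1 - 1, a.2) 0) 1).1, (cE x (nx2 (a.1 - 1, a.2) 1) 0).1,
          (cE x (a.1 - 1, a.2) 1).1} := by
  -- box bookkeeping
  have bU : inBox2 k (nx2 a 1) := hb
  have bR : inBox2 k (nx2 a 0) := by simp only [inBox2, nx2_zero, abs_le] at *; omega
  have eL : nx2 (a.1 - 1, a.2) 0 = a := by simp only [nx2_zero, sub_add_cancel, Prod.mk.eta]
  have bLR : inBox2 k (nx2 (a.1 - 1, a.2) 0) := by rw [eL]; exact ha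
  have bLU : inBox2 k (nx2 (a.1 - 1, a.2) 1) := by simp only [inBox2, nx2_one, abs_le] at *; omega
  have bLU' : inBox2 k (a.1 - 1, a.2 + 1) := by simp only [inBox2, abs_le] at *; omega
  have bLUR : inBox2 k (nx2 (a.1 - 1, a.2 + 1) 0) := by simp only [inBox2, nx2_zero, abs_le] at *; omega
  have bL1 : inBox2 k ((a.1 - 1, a.2).1 + 1, (a.1 - 1, a.2).2 + 1) := by
    simp only [inBox2, abs_le] at *; omega
  -- the edge and its two flanking chart squares
  obtain ⟨heE, -⟩ := chart_edge_pair hA hx a 1 ha bU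
  obtain ⟨qa, hqaQ, hqa⟩ := (hA.chart hx).2.2.2.2 a ha hc
  obtain ⟨qb, hqbQ, hqb⟩ := (hA.chart hx).2.2.2.2 (a.1 - 1, a.2) hd bL1
  have hea : ∃ i, (bd qa i).1 = (cE x a 1).1 := mem_image_fst_bd.1 (by rw [hqa]; simp)
  have heb : ∃ i, (bd qb i).1 = (cE x a 1).1 := mem_image_fst_bd.1 (by rw [hqb, eL]; simp)
  -- the two flanking squares differ: the right-edge at `a` is an edge of `qa` but not of `qb`
  have hab : qa ≠ qb := by
    intro h
    have hm : (cE x a 0).1 ∈ Finset.univ.image (Prod.fst ∘ bd qb) := by rw [← h, hqa]; simp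
    rw [hqb, eL] at hm
    simp only [nx2_one, mem_insert, mem_singleton] at hm
    rcases hm with hm | hm | hm | hm
    · exact cE_ne hA hx ha bR hd bLR (Or.inl (by simp; omega)) hm
    · exact cE_ne hA hx ha bR ha bU (Or.inr (Or.inr (by decide))) hm
    · exact cE_ne hA hx ha bR bLU' bLUR (Or.inl (by simp; omega)) hm
    · exact cE_ne hA hx ha bR hd bLU (Or.inr (Or.inr (by decide))) hm
  rcases eq_or_eq_of_two_squares hA.2.2.1 heE hqaQ hqbQ hq hea heb hqe hab with rfl | rfl
  · exact Or.inl hqa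
  · exact Or.inr hqb

end StubChartInterior

open StubChartInterior in
/-- **Registered stub `stub_chartInterior`** of the skeleton `Cruxes/CurvatureUniformityR/Lines/Sketch.lean` (line
`single-chart-markov`): the `G`-free chart combinatorics `ChartInteriorStructure` of a repaired-admissible complex
around a flat base point — (E0) `cE_inj`, (E1) `edgesAt_eq`, (E2) `sq_through_edge_zero` / `sq_through_edge_one`. -/
theorem stub_chartInterior : ChartInteriorStructure := by
  intro k j V E Q σ τ bd cV cE _ hA x hx
  refine ⟨fun a a' μ μ' ha hb ha' hb' h => cE_inj hA hx ha hb ha' hb' h,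
    fun a h1 h2 => edgesAt_eq hA hx h1 h2, ?_⟩
  intro a μ ha hb hc hd q hq hqe
  obtain rfl | rfl : μ = 0 ∨ μ = 1 := by omega
  · exact sq_through_edge_zero hA hx a ha hb hc hd hq hqe
  · exact sq_through_edge_one hA hx a ha hb hc hd hq hqe

end Summit.QuantumFields.YangMills.Cruxes.CurvatureUniformityR.SingleChartMarkov
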